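import Summits.SmoothPoincare4.SmoothPoincare4.Theses.EntropyRung
import Literature.Geometry.Riemannian.RoundCylinderFour
import Literature.Geometry.Riemannian.WeylEnergy

/-!
# Sketch — crux-ideate round 2, ideator 4, crux `EntropyRung.ConicalGap` (stmt-SmoothPoincare4-16589)

First lemmas of the two idea cards, typed over existing declarations (no new facts asserted):

* card `far-neck-certificate`: `HasNeck`, `NeckCertificate`, `ThinConeNeck`, `NeckRigidity`,
  `ConicalGapThin`, and the logic `conicalGapThin_of` (thin-cone regime of the crux from the two stubs);
* card `weyl-vanishing-transfer`: `LcfThreshold` (the transfer C⁺), `LcfNoncompactGap` (known: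
  Zhang 2009 / Petersen–Wylie 2010 / Cao–Wang–Zhang 2011 / Munteanu–Sesum 2013 + the cylinder mass),
  and the logic `conicalGap_of_lcfThreshold : LcfNoncompactGap → LcfThreshold → ConicalGap`.
-/

noncomputable section

set_option linter.dupNamespace false

open Bundle Set Function Filter Manifold Metric Module MeasureTheory
open scoped Manifold ContDiff Topology RealInnerProductSpace ENNReal NNReal
open Literature.Geometry.Lorentzian Literature.Geometry.Lorentzian.PseudoRiemannianMetric
open Literature.Geometry.Riemannian

namespace Summit.SmoothPoincare4.SmoothPoincare4.Cruxes.ConicalGap.Ideator4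

open Summit.SmoothPoincare4.SmoothPoincare4.Theses.EntropyRung

/-- The crux's mass bound `32π²√π e^{-3/2} = (4π)²·Θ(S³×ℝ) ≈ 124.9`. -/
def massBound : ℝ := 32 * Real.pi ^ 2 * Real.sqrt Real.pi * Real.exp (-(3 : ℝ) / 2)

/-! ## Card `far-neck-certificate` -/

/-- **`(η, L)`-neck modelled on the tree's round cylinder `S³(2)×ℝ = (P4, cylP)`**: a region of `M`
is `(1±η)`-quasi-isometric, with scalar curvature `η`-close to `3/2`, to the slab
`{y ∈ ℝ⁴∖0 : |z| < L}`, `z = log |y|²` (= `2 log |y|`, the axial coordinate of the cylinder model,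
`f_cyl = z²/4 + 3/2`). Transplant maps `Φ, Ψ` in the style of `ShrinkerSplittingAtInfinity`. -/
def HasNeck (M : Type) [TopologicalSpace M] [ChartedSpace (EuclideanSpace ℝ (Fin 4)) M]
    [IsManifold (𝓡 4) ∞ M]
    (g : PseudoRiemannianMetric (𝓡 4) ∞ (EuclideanSpace ℝ (Fin 4)) (TangentSpace (𝓡 4) : M → Type _))
    [g.HasLeviCivita] (η L : ℝ) : Prop :=
  ∃ (U : Set RoundCylinderFour.P4) (Φ : RoundCylinderFour.P4 → M) (Ψ : M → RoundCylinderFour.P4),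
    IsOpen U ∧
    {y : RoundCylinderFour.P4 | |Real.log (‖(y : EuclideanSpace ℝ (Fin 4))‖ ^ 2)| < L} ⊆ U ∧
    ContMDiffOn 𝓘(ℝ, EuclideanSpace ℝ (Fin 4)) (𝓡 4) ∞ Φ U ∧ IsOpen (Φ '' U) ∧
    ContMDiffOn (𝓡 4) 𝓘(ℝ, EuclideanSpace ℝ (Fin 4)) ∞ Ψ (Φ '' U) ∧ (∀ y ∈ U, Ψ (Φ y) = y) ∧
    (∀ y ∈ U, ∀ v : EuclideanSpace ℝ (Fin 4),
      (1 - η) * RoundCylinderFour.cylP.val y v v ≤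
        g.val (Φ y) (mfderiv 𝓘(ℝ, EuclideanSpace ℝ (Fin 4)) (𝓡 4) Φ y v)
          (mfderiv 𝓘(ℝ, EuclideanSpace ℝ (Fin 4)) (𝓡 4) Φ y v) ∧
      g.val (Φ y) (mfderiv 𝓘(ℝ, EuclideanSpace ℝ (Fin 4)) (𝓡 4) Φ y v)
          (mfderiv 𝓘(ℝ, EuclideanSpace ℝ (Fin 4)) (𝓡 4) Φ y v) ≤
        (1 + η) * RoundCylinderFour.cylP.val y v v) ∧
    (∀ y ∈ U, |g.scalarCurvature (Φ y) - 3 / 2| ≤ η)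

/-- **NECK CERTIFICATE** (first lemma of card `far-neck-certificate`; Perelman–Li–Wang: `log Θ(M) =
ν(g) = inf_τ μ(g,τ) ≤ 𝒲(g, ψ, 1)` for the axial Gaussian slab `ψ` transplanted onto an `(η,L)`-neck,
whose value tends to `ν_cyl` as `η → 0`, `L → ∞`): for every `ε > 0` there are `η > 0`, `L` such that
every complete connected normalised 4-d gradient shrinker containing an `(η, L)`-neck ANYWHERE has
`∫ e^{-f} dV ≤ (1 + ε)·32π²√π e^{-3/2}`. No decay / non-compactness / non-flatness clause is needed. -/
def NeckCertificate : Prop :=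
  ∀ ε : ℝ, 0 < ε → ∃ η : ℝ, 0 < η ∧ ∃ L : ℝ, 0 < L ∧
  ∀ (M : Type) [TopologicalSpace M] [T2Space M] [SecondCountableTopology M]
    [ChartedSpace (EuclideanSpace ℝ (Fin 4)) M] [IsManifold (𝓡 4) ∞ M] [ConnectedSpace M]
    [T3Space M] [MeasurableSpace M] [BorelSpace M]
    (g : PseudoRiemannianMetric (𝓡 4) ∞ (EuclideanSpace ℝ (Fin 4)) (TangentSpace (𝓡 4) : M → Type _))
    [g.HasLeviCivita] (f : M → ℝ) (hg : g.IsRiemannian),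
    (∀ (x : M) (r : NNReal), IsCompact {y : M | g.edist hg x y ≤ r}) →
    ContMDiff (𝓡 4) 𝓘(ℝ, ℝ) ∞ f →
    (∀ (x : M) (X Y : TangentSpace (𝓡 4) x),
      g.ricci x X Y + g.hessian f x X Y = (1 / 2 : ℝ) * g.val x X Y) →
    (∀ x : M, g.scalarCurvature x + g.gradSq f x = f x) →
    HasNeck M g η L →
    ∫⁻ x, ENNReal.ofReal (Real.exp (-f x))
        ∂(riemannianMeasure (g.toContMDiffRiemannianMetric hg)) ≤
      ENNReal.ofReal ((1 + ε) * massBound)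

/-- **THIN CONES CARRY FAR NECKS** (the structural stub of card `far-neck-certificate`): on the crux
class (complete connected non-compact normalised shrinker with `R → 0` at infinity), a small enough
asymptotic volume ratio `a` — typed by the sublevel-volume clause `Vol{f < t} ≤ 8π²·a·t²` for all
large `t`, the banked `helper_sublevelAvr_exists` form of AVR — forces an `(η, L)`-neck (far out along
the end: the long near-cylindrical stretch `a(s) ≈ 2`, `R ≈ 3/2`, `s ∈ (O(1), O(a^{-1/3}))` of the
SO(4) model ends, numerics `compute/thin_ends.py`; mechanism: the level sets of `f` flow by the
normalised link Ricci flow `∂_u ĥ = Ric(ĥ) − 2ĥ`, `u = 2/s²`, Munteanu–Wang 1606.01861 §1/Thm 1.7). -/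
def ThinConeNeck : Prop :=
  ∀ η : ℝ, 0 < η → ∀ L : ℝ, 0 < L → ∃ a : ℝ, 0 < a ∧
  ∀ (M : Type) [TopologicalSpace M] [T2Space M] [SecondCountableTopology M]
    [ChartedSpace (EuclideanSpace ℝ (Fin 4)) M] [IsManifold (𝓡 4) ∞ M] [ConnectedSpace M]
    [NoncompactSpace M] [T3Space M] [MeasurableSpace M] [BorelSpace M]
    (g : PseudoRiemannianMetric (𝓡 4) ∞ (EuclideanSpace ℝ (Fin 4)) (TangentSpace (𝓡 4) : M → Type _))
    [g.HasLeviCivita] (f : M → ℝ) (hg : g.IsRiemannian),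
    (∀ (x : M) (r : NNReal), IsCompact {y : M | g.edist hg x y ≤ r}) →
    ContMDiff (𝓡 4) 𝓘(ℝ, ℝ) ∞ f →
    (∀ (x : M) (X Y : TangentSpace (𝓡 4) x),
      g.ricci x X Y + g.hessian f x X Y = (1 / 2 : ℝ) * g.val x X Y) →
    (∀ x : M, g.scalarCurvature x + g.gradSq f x = f x) →
    (∃ x : M, g.scalarCurvature x ≠ 0) →
    (∀ ε : ℝ, 0 < ε → ∃ K : Set M, IsCompact K ∧ ∀ x, x ∉ K → g.scalarCurvature x < ε) →
    (∃ T : ℝ, ∀ t : ℝ, T ≤ t →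
      riemannianMeasure (g.toContMDiffRiemannianMetric hg) {x : M | f x < t} ≤
        ENNReal.ofReal (8 * Real.pi ^ 2 * a * t ^ 2)) →
    HasNeck M g η L

/-- **NECK RIGIDITY** (the sharpening stub: pinched Perelman monotonicity between the neck scale and
the blow-down propagates cylindricity across scales — Colding–Minicozzi 2109.06240 / Li–Wang 2024 —
so a NON-FLAT shrinker with a fine enough neck is either the cylinder or strictly sub-cylindrical):
some `(η, L)`-neck already forces the SHARP bound. -/
def NeckRigidity : Prop :=
  ∃ η : ℝ, 0 < η ∧ ∃ L : ℝ, 0 < L ∧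
  ∀ (M : Type) [TopologicalSpace M] [T2Space M] [SecondCountableTopology M]
    [ChartedSpace (EuclideanSpace ℝ (Fin 4)) M] [IsManifold (𝓡 4) ∞ M] [ConnectedSpace M]
    [T3Space M] [MeasurableSpace M] [BorelSpace M]
    (g : PseudoRiemannianMetric (𝓡 4) ∞ (EuclideanSpace ℝ (Fin 4)) (TangentSpace (𝓡 4) : M → Type _))
    [g.HasLeviCivita] (f : M → ℝ) (hg : g.IsRiemannian),
    (∀ (x : M) (r : NNReal), IsCompact {y : M | g.edist hg x y ≤ r}) →
    ContMDiff (𝓡 4) 𝓘(ℝ, ℝ) ∞ f →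
    (∀ (x : M) (X Y : TangentSpace (𝓡 4) x),
      g.ricci x X Y + g.hessian f x X Y = (1 / 2 : ℝ) * g.val x X Y) →
    (∀ x : M, g.scalarCurvature x + g.gradSq f x = f x) →
    (∃ x : M, g.scalarCurvature x ≠ 0) →
    HasNeck M g η L →
    ∫⁻ x, ENNReal.ofReal (Real.exp (-f x))
        ∂(riemannianMeasure (g.toContMDiffRiemannianMetric hg)) ≤ ENNReal.ofReal massBound

/-- The THIN-CONE REGIME of the crux: `ConicalGap` restricted to shrinkers whose sublevel volume
ratio is eventually `≤ a`. -/
def ConicalGapThin (a : ℝ) : Prop :=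
  ∀ (M : Type) [TopologicalSpace M] [T2Space M] [SecondCountableTopology M]
    [ChartedSpace (EuclideanSpace ℝ (Fin 4)) M] [IsManifold (𝓡 4) ∞ M] [ConnectedSpace M]
    [NoncompactSpace M] [T3Space M] [MeasurableSpace M] [BorelSpace M]
    (g : PseudoRiemannianMetric (𝓡 4) ∞ (EuclideanSpace ℝ (Fin 4)) (TangentSpace (𝓡 4) : M → Type _))
    [g.HasLeviCivita] (f : M → ℝ) (hg : g.IsRiemannian),
    (∀ (x : M) (r : NNReal), IsCompact {y : M | g.edist hg x y ≤ r}) →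
    ContMDiff (𝓡 4) 𝓘(ℝ, ℝ) ∞ f →
    (∀ (x : M) (X Y : TangentSpace (𝓡 4) x),
      g.ricci x X Y + g.hessian f x X Y = (1 / 2 : ℝ) * g.val x X Y) →
    (∀ x : M, g.scalarCurvature x + g.gradSq f x = f x) →
    (∃ x : M, g.scalarCurvature x ≠ 0) →
    (∀ ε : ℝ, 0 < ε → ∃ K : Set M, IsCompact K ∧ ∀ x, x ∉ K → g.scalarCurvature x < ε) →
    (∃ T : ℝ, ∀ t : ℝ, T ≤ t →
      riemannianMeasure (g.toContMDiffRiemannianMetric hg) {x : M | f x < t} ≤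
        ENNReal.ofReal (8 * Real.pi ^ 2 * a * t ^ 2)) →
    ∫⁻ x, ENNReal.ofReal (Real.exp (-f x))
        ∂(riemannianMeasure (g.toContMDiffRiemannianMetric hg)) ≤ ENNReal.ofReal massBound

/-- **Logic of the line on the thin regime**: neck rigidity + thin cones carry necks ⇒ the crux on
`{AVR ≤ a₀}` for some `a₀ > 0`. [folklore] -/
theorem conicalGapThin_of (hR : NeckRigidity) (hT : ThinConeNeck) : ∃ a : ℝ, 0 < a ∧ ConicalGapThin a := by
  obtain ⟨η, hη, L, hL, hrig⟩ := hR
  obtain ⟨a, ha, hneck⟩ := hT η hη L hL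
  refine ⟨a, ha, ?_⟩
  intro M _ _ _ _ _ _ _ _ _ _ g _ f hg hc hf hsol hnorm hnf hdec havr
  exact hrig M g f hg hc hf hsol hnorm hnf (hneck M g f hg hc hf hsol hnorm hnf hdec havr)

/-- The crux's bound equals `massBound` (bookkeeping). -/
theorem massBound_eq : massBound = 32 * Real.pi ^ 2 * Real.sqrt Real.pi * Real.exp (-(3 : ℝ) / 2) := rfl

/-! ## Card `weyl-vanishing-transfer` -/

/-- **TRANSFER `C⁺` (LCF THRESHOLD)**: a complete connected NON-COMPACT normalised 4-d gradient
shrinker denser than the cylinder (`∫ e^{-f} dV > 32π²√π e^{-3/2}`) is locally conformally flat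
(`|W|² ≡ 0`, the tree's pointwise `weylNormSq`). Equivalent to the parent crux modulo the lcf
classification; attacked through the Cao–Chen tensor `D` (`W(∇f,·,·,·) + C = D`), the elliptic system
for `W`, and the weighted Gauss–Bonnet–Morse identity. -/
def LcfThreshold : Prop :=
  ∀ (M : Type) [TopologicalSpace M] [T2Space M] [SecondCountableTopology M]
    [ChartedSpace (EuclideanSpace ℝ (Fin 4)) M] [IsManifold (𝓡 4) ∞ M] [ConnectedSpace M]
    [NoncompactSpace M] [T3Space M] [MeasurableSpace M] [BorelSpace M]
    (g : PseudoRiemannianMetric (𝓡 4) ∞ (EuclideanSpace ℝ (Fin 4)) (TangentSpace (𝓡 4) : M → Type _))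
    [g.HasLeviCivita] (f : M → ℝ) (hg : g.IsRiemannian),
    (∀ (x : M) (r : NNReal), IsCompact {y : M | g.edist hg x y ≤ r}) →
    ContMDiff (𝓡 4) 𝓘(ℝ, ℝ) ∞ f →
    (∀ (x : M) (X Y : TangentSpace (𝓡 4) x),
      g.ricci x X Y + g.hessian f x X Y = (1 / 2 : ℝ) * g.val x X Y) →
    (∀ x : M, g.scalarCurvature x + g.gradSq f x = f x) →
    ENNReal.ofReal massBound <
      ∫⁻ x, ENNReal.ofReal (Real.exp (-f x)) ∂(riemannianMeasure (g.toContMDiffRiemannianMetric hg)) →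
    ∀ x : M, g.weylNormSq x = 0

/-- **KNOWN (named-fact candidate)**: a complete connected non-compact NON-FLAT normalised 4-d
gradient shrinker with `W ≡ 0` has `∫ e^{-f} dV ≤ 32π²√π e^{-3/2}` — locally conformally flat
complete shrinkers are finite quotients of `ℝ⁴`, `S³×ℝ`, `S⁴` (Z.-H. Zhang 2009; Petersen–Wylie 2010;
Cao–Wang–Zhang 2011; Munteanu–Sesum 2013, any of them), and `(S³/Γ)×ℝ` has mass `32π²√πe^{-3/2}/|Γ|`. -/
def LcfNoncompactGap : Prop :=
  ∀ (M : Type) [TopologicalSpace M] [T2Space M] [SecondCountableTopology M]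
    [ChartedSpace (EuclideanSpace ℝ (Fin 4)) M] [IsManifold (𝓡 4) ∞ M] [ConnectedSpace M]
    [NoncompactSpace M] [T3Space M] [MeasurableSpace M] [BorelSpace M]
    (g : PseudoRiemannianMetric (𝓡 4) ∞ (EuclideanSpace ℝ (Fin 4)) (TangentSpace (𝓡 4) : M → Type _))
    [g.HasLeviCivita] (f : M → ℝ) (hg : g.IsRiemannian),
    (∀ (x : M) (r : NNReal), IsCompact {y : M | g.edist hg x y ≤ r}) →
    ContMDiff (𝓡 4) 𝓘(ℝ, ℝ) ∞ f →
    (∀ (x : M) (X Y : TangentSpace (𝓡 4) x),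
      g.ricci x X Y + g.hessian f x X Y = (1 / 2 : ℝ) * g.val x X Y) →
    (∀ x : M, g.scalarCurvature x + g.gradSq f x = f x) →
    (∃ x : M, g.scalarCurvature x ≠ 0) →
    (∀ x : M, g.weylNormSq x = 0) →
    ∫⁻ x, ENNReal.ofReal (Real.exp (-f x))
        ∂(riemannianMeasure (g.toContMDiffRiemannianMetric hg)) ≤ ENNReal.ofReal massBound

/-- **The transfer concludes the crux (and in fact the parent)**: `LcfNoncompactGap → LcfThreshold →
ConicalGap`, by cases on the mass. [folklore] -/
theorem conicalGap_of_lcfThreshold (hK : LcfNoncompactGap) (hT : LcfThreshold) : ConicalGap := by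
  intro M _ _ _ _ _ _ _ _ _ _ g _ f hg hc hf hsol hnorm hnf _
  rcases le_or_gt (∫⁻ x, ENNReal.ofReal (Real.exp (-f x))
      ∂(riemannianMeasure (g.toContMDiffRiemannianMetric hg))) (ENNReal.ofReal massBound) with h | h
  · exact h
  · exact hK M g f hg hc hf hsol hnorm hnf (hT M g f hg hc hf hsol hnorm h)

/-- The same transfer closes the parent crux verbatim. [folklore] -/
theorem noncompactShrinkerGap_of_lcfThreshold (hK : LcfNoncompactGap) (hT : LcfThreshold) :
    NoncompactShrinkerGap := by
  intro M _ _ _ _ _ _ _ _ _ _ g _ f hg hc hf hsol hnorm hnf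
  rcases le_or_gt (∫⁻ x, ENNReal.ofReal (Real.exp (-f x))
      ∂(riemannianMeasure (g.toContMDiffRiemannianMetric hg))) (ENNReal.ofReal massBound) with h | h
  · exact h
  · exact hK M g f hg hc hf hsol hnorm hnf (hT M g f hg hc hf hsol hnorm h)

end Summit.SmoothPoincare4.SmoothPoincare4.Cruxes.ConicalGap.Ideator4

end
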